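import Summits.ResolutionOfSingularities.ResolutionOfSingularities.Theorems.RadicialJungCleanModelsNSCoordinateLift
import Literature.AlgebraicGeometry.Resolution.NodalBlowupChartAlgebra
import Literature.AlgebraicGeometry.Resolution.RegularCentreLocal
import HarnessLib

/-!
# The coordinate lift, r.s.p. form: the quasi-regularity hypothesis discharged from «part of a regular system of parameters of the residue-side local ring»

Route `RadicialJung`, crux `CleanModels` (stmt-ResolutionOfSingularities-15917), registered skeleton `Cruxes/CleanModels/Lines/Sketch.lean`
rev 35 (sha16 de44649d8f729c3b), stub 7 `stub_cleanModelsDimGEFour`.  Explicit-unit seat `decomp-res-hand-2` g5 (structural hand); memo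
`Cruxes/CleanModels/Lines/Sketch-memo-hand2-g5-stubs-5-7.md` §3 item 2.  OURS; structural bookkeeping, counted 0; nothing here proves resolution of
singularities in characteristic `p`.

✓ `centre_locAtCentre_adjoin_div_le_map` asks that the residues `(z̄₀, …, z̄_s)` be QUASI-REGULAR in `locAtCentre A O ⧸ 𝔭`.  In the assembly the
residue ring is only known through a ring isomorphism with a residue-side regular local ring `S` (e.g. `θ.range ⊆ κ(O₁)`,
✓ `nonempty_quotCentre_ringEquiv_range`, or a stage `Sq i` of the `ELU3Coord` chain), in which the centre of the blowing up is PART OF A REGULAR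
SYSTEM OF PARAMETERS (tree `IsRsopPart`).  The tree already proves «part of an r.s.p. ⇒ quasi-regular» (✓ `IsRsopPart.isQuasiRegular`,
Matsumura Thm. 16.2 (i)) and «quasi-regularity is invariant under ring isomorphisms» (✓ `IsQuasiRegular.map_ringEquiv`); this file composes them:

* `centre_locAtCentre_adjoin_div_le_map_of_isRsopPart` — the coordinate lift with hypothesis «the images of `(z₀, z)` under ANY ring isomorphism
  `locAtCentre A O ⧸ 𝔭 ≃+* S` are part of a regular system of parameters of `S`».
[cite: NovacoskiSpivakovsky2014, §3.2 and Lemma 2.19] [cite: Matsumura1987, Thm. 16.2 (i)]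
-/

noncomputable section

set_option linter.dupNamespace false -- mandated namespace of this single-conjunct summit

open IsLocalRing
open Literature.AlgebraicGeometry.Resolution

namespace Summit.ResolutionOfSingularities.ResolutionOfSingularities.Theorems.RadicialJung.CleanModels

variable {k K : Type} [Field k] [Field K] [Algebra k K]

/-- **The coordinate lift, r.s.p. form**: as ✓ `centre_locAtCentre_adjoin_div_le_map`, with its quasi-regularity hypothesis replaced by «under a
ring isomorphism `e : locAtCentre A O ⧸ 𝔭 ≃+* S` onto a local ring `S`, the images of `z₀, z₁, …, z_s` are part of a regular system of parameters
of `S`» (✓ `IsRsopPart.isQuasiRegular`, ✓ `IsQuasiRegular.map_ringEquiv`). [cite: Matsumura1987, Thm. 16.2 (i)] -/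
theorem centre_locAtCentre_adjoin_div_le_map_of_isRsopPart (O O₁ : ValuationSubring K) (hO : O ≤ O₁)
    (A : Subalgebra k K) (hA : A.toSubring ≤ O.toSubring) (hAfg : A.FG)
    {s : ℕ} (z₀ : K) (z : Fin s → K) (hz₀A : z₀ ∈ A) (hzA : ∀ l, z l ∈ A)
    (hz₀Q : O.valuation z₀ < 1) (hz₀P : O₁.valuation z₀ = 1) (hmin : ∀ l, O.valuation (z l) ≤ O.valuation z₀)
    {S : Type} [CommRing S] [IsLocalRing S]
    (e : (locAtCentre A.toSubring O ⧸ (maximalIdeal O₁).comap (Subring.inclusion ((locAtCentre_le hA).trans hO))) ≃+* S)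
    (hrsop : IsRsopPart (fun i : Fin (s + 1) =>
      e (Ideal.Quotient.mk ((maximalIdeal O₁).comap (Subring.inclusion ((locAtCentre_le hA).trans hO)))
        ((Fin.cons (⟨z₀, le_locAtCentre _ _ hz₀A⟩ : locAtCentre A.toSubring O)
          (fun l => (⟨z l, le_locAtCentre _ _ (hzA l)⟩ : locAtCentre A.toSubring O)) :
            Fin (s + 1) → locAtCentre A.toSubring O) i)))) :
    ∃ (_ : (A ⊔ Algebra.adjoin k (Set.range fun l => z l / z₀)).toSubring ≤ O.toSubring),
      (A ⊔ Algebra.adjoin k (Set.range fun l => z l / z₀)).FG ∧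
      locAtCentre (A ⊔ Algebra.adjoin k (Set.range fun l => z l / z₀)).toSubring O₁ = locAtCentre A.toSubring O₁ ∧
      ∀ f : locAtCentre (A ⊔ Algebra.adjoin k (Set.range fun l => z l / z₀)).toSubring O,
        O₁.valuation (f : K) < 1 →
          f ∈ ((maximalIdeal O₁).comap (Subring.inclusion ((locAtCentre_le hA).trans hO))).map
            (Subring.inclusion (locAtCentre_mono O
              (show A.toSubring ≤ (A ⊔ Algebra.adjoin k (Set.range fun l => z l / z₀)).toSubring from
                fun _ hx => (le_sup_left : A ≤ A ⊔ Algebra.adjoin k (Set.range fun l => z l / z₀)) hx))) := by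
  refine centre_locAtCentre_adjoin_div_le_map O O₁ hO A hA hAfg z₀ z hz₀A hzA hz₀Q hz₀P hmin ?_
  have h := hrsop.isQuasiRegular.map_ringEquiv e.symm
  have hcomp : (e.symm ∘ fun i : Fin (s + 1) =>
      e (Ideal.Quotient.mk ((maximalIdeal O₁).comap (Subring.inclusion ((locAtCentre_le hA).trans hO)))
        ((Fin.cons (⟨z₀, le_locAtCentre _ _ hz₀A⟩ : locAtCentre A.toSubring O)
          (fun l => (⟨z l, le_locAtCentre _ _ (hzA l)⟩ : locAtCentre A.toSubring O)) :
            Fin (s + 1) → locAtCentre A.toSubring O) i))) =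
      fun i : Fin (s + 1) =>
        Ideal.Quotient.mk ((maximalIdeal O₁).comap (Subring.inclusion ((locAtCentre_le hA).trans hO)))
          ((Fin.cons (⟨z₀, le_locAtCentre _ _ hz₀A⟩ : locAtCentre A.toSubring O)
            (fun l => (⟨z l, le_locAtCentre _ _ (hzA l)⟩ : locAtCentre A.toSubring O)) :
              Fin (s + 1) → locAtCentre A.toSubring O) i) := by
    funext i
    simp only [Function.comp, RingEquiv.symm_apply_apply]
  rw [hcomp] at h
  exact h

end Summit.ResolutionOfSingularities.ResolutionOfSingularities.Theorems.RadicialJung.CleanModels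

end
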